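import Mathlib
import HarnessLib
import HarnessLib.Audit
import Summits.ResolutionOfSingularities.Statement
import HarnessLib.Audit.Status.Attr

/-!
Route: RuledResidues

DORMANT since 2026-08-25T11:46:41Z (reconciler: no traction for 7.7 d (last activity item-evidence-added at 2026-08-17T19:13:52Z); parked, not closed — `ledger route dormant route-ResolutionOfSingularities-RuledResidues --off` to reacti) — unstaffed, not closed; items shared with open routes are served there. `ledger route dormant <id> --off` reactivates.

# Route RuledResidues — infinitely many non-ruled divisorial residue fields over one singular locus
— a ruledness-sieve certificate that refutes the summit

REFUTATION-SHAPED certificate route (operator computational-witness; `closes` concludes `¬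
ResolutionOfSingularities`). It suffices to
EXHIBIT X = NonRuledDivisors (crux 2, THE WITNESS): a prime p, a field k of characteristic p, a
finitely generated k-subalgebra R of a
field K with Frac R = K (an affine model), and INFINITELY MANY divisorial places W of K/k (k ⊆ W, W
a discrete valuation ring that is a
localisation of a finitely generated k-subalgebra) containing R, CENTRED AT SINGULAR POINTS of Spec
R (the localisation of R at the
centre 𝔪_W ∩ R is not regular), whose residue fields are NOT RULED over k (κ(W) ≠ L(t) for every
subfield L ⊇ k and t transcendental
over L). Two killing lemmas, consequences of nothing but `Scheme.HasResolution (Spec R)`: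
NonRuledCofinite (crux 3, EXCEPTIONAL PRIMES
ARE FINITE): if Spec R has a resolution, all but finitely many divisorial places centred in Sing R
dominate a REGULAR local ring of
dimension ≥ 2 of some affine model of K; RegularModelRuled (crux 4, ABHYANKAR 1956 Prop. 4): such
places have ruled residue fields.
Since the summit hands Spec R a resolution, X refutes it. Card realised: abhyankar-ruledness-sieve
(spine: its shadow (R) and its
dimension-4 sieve, typed over Mathlib and made a deciding route; its Nash half (N) and its
dimension-3 mining K1 are not filed).
Lean: `NonRuledDivisors ∧ RegularModelRuled ∧ NonRuledCofinite`

## Assembly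
Pure logic over the Statement's own cone (glue.lean `closes`, CRUX-ONLY hypotheses, Sketch.lean lean
check rc 0, 0 sorries): assume the
summit; unpack NonRuledDivisors into (p, k, K, R) and the infinite set 𝒩;
`ResolutionOfSingularities_iff` gives ResolutionInChar p;
instantiate it at Spec R → Spec k (R a domain hence reduced; affine hence separated and
quasi-compact; finitely generated hence locally of
finite type — `HasRingHomProperty.Spec_iff` + `RingHom.finiteType_algebraMap`, verbatim WildPurity's
certified step) to get
`Scheme.HasResolution (Spec R)`; NonRuledCofinite makes the subset of 𝒩 without a good regular model
finite, so 𝒩 ⊆ that finite set once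
RegularModelRuled turns every good model into ruledness, contradicting `Set.Infinite 𝒩`. Every crux
is a binder and occurs in the term. The Assembly item `NonRuledDivisors → RegularModelRuled →
NonRuledCofinite → ¬ summit` is `closes` verbatim (D-0027 §2.1).

Rationale: WHY THIS LINE. Every one of the 35 open routes except WildPurity is a POSITIVE line, and the one
refutation instrument on the ledger tests Kato-cohomology
purity at a single DEFECT place. Abhyankar's classical lemma (Abhyankar1956Valuations Prop. 4, as
used by Nash and by Ishii–Kollár
arXiv:math/0207171 Ex. 2.5: an exceptional divisor over a regular point is ruled) turns the mere
EXISTENCE of a resolution of Spec R into a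
finiteness statement about the whole Riemann–Zariski space that needs no resolution to state — the
non-ruled divisorial places over
Sing R are finitely many (each is a divisor ON every resolution) — so ONE affine fourfold carrying
infinitely many of them is a finite,
resolution-free refutation. The witness is machine-huntable because (card P3) the INERT stages (p |
ord) of any wild blow-up run create
exceptional primes whose residue fields are Zariski varieties w^p = G(y) ⊂ P(1,…,1,d/p), and their
non-ruledness is CERTIFIED by
Kollár's instability criterion (doi:10.2307/2152888 Thm. 11 / Lemma 7: a p-cyclic cover of P^(n-1)
branched in degree d = pa with
pa > n and Kollár-simple critical points is not separably uniruled, hence not ruled; weighted form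
doi:10.1017/s0027763000009612 Thm.
1.3). Imported areas: valuation theory of function fields (prime divisors, quadratic transforms),
birational geometry of uniruled
varieties in char p (Kollár, Okada), the Nash-problem literature (essential divisors). What it does
that no route does: it counts what
every resolution must contain instead of running or certifying a process, and its positive
by-products (the two kills, provable now)
are theorems of the tree whatever the hunt returns.

RANKED CRUXES. #2 NonRuledDivisors (crux) — THE WITNESS — there exist a prime p, a field k of
characteristic p, a field K with an affine model R (finitely generated k-subalgebra, Frac R = K) and
INFINITELY MANY divisorial places W ⊇ R of K/k centred at non-regular points of Spec R whose residue
fields are not ruled over k (card abhyankar-ruledness-sieve K2/NRF(4) negated at one model; format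
of the hunt: self-similar germ, bc/NonRuledDivisors_birth.lean). [difficulty: open-problem] (why it
might fail: resolution may simply be true (then the kills force finiteness); eternal wild runs live
at DEGENERATE initial forms (monomial × unit, cones) whose Zariski 3-folds are ruled, while
Kollár-simple inert stages force an immediate multiplicity drop.) [Abhyankar1956Valuations,
arXiv:math/0207171, doi:10.2307/2152888, doi:10.1017/s0027763000009612, arXiv:1802.05010,
arXiv:1412.0868]
#3 NonRuledCofinite (crux) — EXCEPTIONAL PRIMES ARE FINITE — for every field k, field K and affine
model R of K over k (finitely generated, Frac R = K): if Spec R has a resolution of singularities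
then the set of divisorial places W ⊇ R of K/k centred in Sing R that do NOT dominate a regular
local ring of dimension ≥ 2 of some affine model A of K (A finitely generated, Frac A = K, A ⊆ W, A
regular at the centre of W with Krull dimension ≥ 2 there) is FINITE (such W are the local rings of
the codimension-one points of the resolution lying over Sing R; skeleton
bc/NonRuledCofinite_birth.lean: finitely many everywhere-regular charts + per-chart finiteness via
denominator ideals). [difficulty: L] (why it might fail: it cannot fail mathematically (valuative
criterion + finitely many codimension-one components over Sing R); the risk is Lean size —
identifying HasResolution's source with finitely many affine k-subalgebras of K with all local rings
regular.) [ZariskiSamuel1960, Hartshorne1977, Abhyankar1956Valuations,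
Literature.AlgebraicGeometry.Resolution.Scheme.HasResolution]
#4 RegularModelRuled (crux) — ABHYANKAR'S RULEDNESS (characteristic-free, any ground field) — a
divisorial place W of K/k dominating a REGULAR local ring of dimension ≥ 2 of an affine model A of K
(A finitely generated, Frac A = K, A ⊆ W) has residue field L(t): some subfield L ⊇ k of κ(W) and t
∈ κ(W) transcendental over L with κ(W) = L(t). Proof plan (skeleton
bc/RegularModelRuled_birth.lean): W is a prime divisor of A_𝔮 (dimension formula), the quadratic
sequence of A_𝔮 along W is finite (Abhyankar), its penultimate member S is regular of dimension ≥ 2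
with W the 𝔪_S-adic order valuation, whose residue field is κ(S)(t_1..t_c), c ≥ 1. [difficulty: M]
(why it might fail: true (Abhyankar 1956 Prop. 3–4; Zariski–Samuel VI §14); transcription risks
only: the order-valuation identification at the last quadratic transform and the dimension formula
for the centre over an arbitrary (imperfect) k.) [Abhyankar1956Valuations, ZariskiSamuel1960,
arXiv:math/0207171]

TWO-LAYER PLAN. NonRuledDivisors ⇐ SelfSimilarGerm (a singular local ring S of R, a k-automorphism σ
of K with σ(S) ⊆ S locally, one non-ruled divisorial
W₀ dominating S with pairwise distinct σ-iterated preimages — OPEN, the hunt) →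
TransportAlongIterates (true) → CentreSingular (true) →
NonRuledDivisors (proved in bc/NonRuledDivisors_birth.lean). NonRuledCofinite ⇐ FiniteRegularCharts
→ ChartExceptionalFinite (both true).
RegularModelRuled ⇐ PenultimateRing (Abhyankar's finiteness of the quadratic sequence along a prime
divisor) → OrderValuationRuled. Filed
only after a census; the witness-side certificate format a compute seat should emit is (R, S, σ, W₀,
Kollár-simplicity data of the
initial form at the inert stage realising W₀, proof of distinctness by domination of the tower
σ⁻ⁿ(S)).

KILL CRITERIA. (i) A proof of NRF(4) resolution-free (finiteness of non-ruled divisorial places over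
the singular locus of every fourfold, e.g. from the
card's K1 law lifted + de Jong uniruledness) refutes NonRuledDivisors in dimension 4 and, in all
dimensions, closes the route
`refuted:NonRuledDivisors` — a new theorem implied by, and evidence for, the summit. (ii) If a
refuter shows the typed ruledness clause
or the typed Sing clause misses the intended notion (a non-ruled κ(W) passing the clause, or a
singular centre passing as regular), REPAIR
by restating (class misstated). (iii) Any positive route landing the summit moots the witness; the
two kills stay as Theorems.

NOT DECOMPOSED YET. The hunt itself (which runs, which starting atoms, which p) is the compute
seat's; the Nash-lifting half of the card (finitely many fat arc
families) is NOT filed (a second, independent witness type — later, if the ruledness sieve proves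
toothless); the card's dimension-3 mining
law K1 (irrational inert stages force an order drop) is a POSITIVE mechanism for the atom routes,
not an item here; uniruled-vs-ruled
refinements (de Jong gives cofinite UNIruledness unconditionally) are layer-2 sharpenings of the
witness format.

CHEAPEST FALSIFIER. Point the sieve at the ledger's certified dimension-4 runs: Hauser–Perlega's e =
3 cycles (barrier ResidualOrderUnboundedExample1/2) and
moh-fails-at-height-two's 13-step chain — their initial forms are monomial × unit, so every inert
stage's Zariski 3-fold is a cone or
linear in a variable, i.e. visibly ruled: NO witness there (expected; triage ba26-g118 predicted
'toothless on known specimens'). The first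
place with teeth: a general wild point of order p ≥ 5 on a 4-fold atom z^p = F — its FIRST inert
stage is already non-ruled by Kollár
Thm 11 (d = p = pa, a = 1, pa > 4), and the sieve predicts the run then drops multiplicity at once
(a Kollár-simple quintic surface has no
point of multiplicity 5). Not run this session (no simulator in this seat); it is the compute seat's
first job and informative either way.

NUMBERS. Dimension ≤ 3: NRF is a THEOREM (CossartPiltant2019 + the kills), so a witness needs trdeg
K ≥ 4. Kollár's condition for w^p = G over
P^(n-1), deg G = pa: pa > n (doi:10.2307/2152888 §12: 'pd + d − n − 2 > 0' in his normalisation);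
for n − 1 = 3: d = pa ≥ 5, so p ≥ 5
at a = 1, p = 2 needs d ∈ {6, 8, …}, p = 3 needs d ∈ {6, 9, …}. Items at open: 4 (3 cruxes +
assembly).

DEFINITION REQUESTS. None blocking (everything is inlined over Mathlib: ValuationSubring,
IsDiscreteValuationRing, Subfield, Polynomial.eval₂, ringKrullDim,
IsRegularLocalRing, Scheme.HasResolution). Convenience notions provers may want factored (file with
`--for` the items if so): `IsRuledOver k κ`
(κ = L(t), L ⊇ k, t transcendental over L) under Literature/FieldTheory; the tree's
`Literature.AlgebraicGeometry.Resolution.IsDivisorialPlace`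
is definitionally the three inlined divisorial conjuncts (`isDivisorialPlace_iff`).

Novelty: Searches (2026-08-17): all 35 open route files read (headers;
ShadowGame/FrobeniusClosing/UniversalCells/WildPurity/JacobianBudget in full);
`ledger idea list --status all` (≈180 cards; full reads of abhyankar-ruledness-sieve,
crepant-not-forced, frobenius-linear-losing-set,
henon-valuations, mu-p-fixed-locus, wild-jets-are-rigid, tau-sheaf, smooth-models-are-cheap,
sparse-is-low-dimensional, certify-monsters,
igusa-zeta, renormalise-the-stall, arrangement-atoms); `ledger negatives` (1); `lit frontier
ResolutionOfSingularities --since 2023` (30 rows;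
arXiv:2602.06553, 2510.05765, 2602.14266 opened); `lit read arxiv:math/0207171 --grep
Abhyankar|ruled` (Ex. 2.5, Rem. 4.4 read);
`lit read doi:10.2307/2152888` (Kollár 1995, pp. 3–5 read: Lemma 7, Thm 11, §12); `lit read
doi:10.1017/s0027763000009612` (Okada 2009,
pp. 2–4: Thm 1.2/1.3); `lit read doi:10.2307/2372519` (Abhyankar 1956: paywalled, acq-00929 open —
quoted through Ishii–Kollár Ex. 2.5);
`lit galaxy search "ruled residue field" --star all` (0), `"prime divisor of the second kind" --star
all` (3: Zariski Collected Papers I,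
MSRI 1987 volume, noise); `lit search --source s2 "resolution of singularities characteristic p
purely inseparable"` (3, none relevant);
`lean search ruled|IsRuled` over Literature/Theorems (0); BC4 `exact?` dedup (3/3 fail).
Nearest prior art found: Abhyankar1956Valuations Prop. 4 and arXiv:math/0207171 Ex. 2.5 / Rem. 4.4
(the lemma and non-ruledness tests,
used FROM a resolution, never as an existe  [refs: 10.2307/2152888`, 10.1017/s0027763000009612`, 10.2307/2372519`, 10.2307/2152888, 10.1017/s0027763000009612, 2602.06553, math/0207171, arxiv:math/0207171, doi:10.2307/2152888, doi:10.1017/s0027763000009612, doi:10.2307/2372519]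

Barriers (technique_class: resolution-shadow, residue-ruledness, refutation): - technique_class: resolution-shadow, residue-ruledness, refutation
- Literature.Barriers.ResolutionOfSingularities.Hauser2003_kangarooShadeIncrease: not met — no
order/shade invariant is tracked and no process must terminate; Hauser's and Hauser–Perlega's runs
are consumed as specimen sources for the sieve (their monomial initial forms make them witness-free,
as the route predicts).
- Literature.Barriers.ResolutionOfSingularities.hauserPerlega_mohProofBoundFails: not met for the
same reason; the e ≥ 3 cycles are unforced and their inert stages carry ruled (toric) Zariski
3-folds — consistent with NRF.
- Literature.Barriers.ResolutionOfSingularities.DimensionFourFrontier: it applies as state of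
knowledge — NRF(4) is a genuine consequence of Res_4 with no independent engine; the bet is the
other direction: a fourfold violating it is a finite refutation, and CossartPiltant2019 makes the
dimension-3 version an oracle for calibrating the sieve.
- Literature.Barriers.ResolutionOfSingularities.InseparableBaseChange: respected — the witness may
live over ANY field of characteristic p (imperfect included: more room), the kills are
field-agnostic commutative algebra, and `closes` instantiates the summit at Spec R over the
witness's own k; regular (not smooth) throughout.
- Literature.Barriers.ResolutionOfSingularities.RegularNotGeometricallyRegular: respected —
ruledness is over the given k, regularity of centres is absolute; no base change occurs.
- Literature.Barriers.ResolutionOfSi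

History (route lifecycle, newest last):
- 2026-08-25T11:46:41Z · DORMANT — reconciler: no traction for 7.7 d (last activity item-evidence-added at 2026-08-17T19:13:52Z); parked, not closed — `ledger route dormant route-ResolutionOfSing (operator:999:1168376)

sub-problem: ResolutionOfSingularities · status: dormant · opened planner-plan-novel-ResolutionOfSingularities-Re-dc19aa3a-d-v2-g25-0 2026-08-17T07:47:19Z · rev 1 · ledger route-ResolutionOfSingularities-RuledResidues
GENERATED by the gate from the ledger (D-0016/17). Provers cite these decls: `theorem foo : Summit.ResolutionOfSingularities.ResolutionOfSingularities.Theses.RuledResidues.<Decl> := …` in Summits/ResolutionOfSingularities/ResolutionOfSingularities/Theorems/<Name>.lean.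
-/

namespace Summit.ResolutionOfSingularities.ResolutionOfSingularities.Theses.RuledResidues

open scoped BigOperators Topology Manifold Classical MeasureTheory ProbabilityTheory Matrix InnerProductSpace ComplexConjugate ContinuousMap
open Filter Set Function TopologicalSpace MeasureTheory

attribute [summit_statement] _root_.ResolutionOfSingularities

/-- item stmt-ResolutionOfSingularities-18075 · crux · rank 2 · open · by planner
why it might fail: resolution may simply be true (then the kills force finiteness); eternal wild runs live at DEGENERATE initial forms (monomial × unit, cones) whose Zariski 3-folds are ruled, while Kollár-simple inert stages force an immediate multiplicity drop.
sources: Abhyankar1956Valuations, arXiv:math/0207171, doi:10.2307/2152888, doi:10.1017/s0027763000009612, arXiv:1802.05010, arXiv:1412.0868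
[crux] THE WITNESS — there exist a prime p, a field k of characteristic p, a field K with an affine
model R (finitely generated k-subalgebra, Frac R = K) and INFINITELY MANY divisorial places W ⊇ R of
K/k centred at non-regular points of Spec R whose residue fields are not ruled over k (card
abhyankar-ruledness-sieve K2/NRF(4) negated at one model; format of the hunt: self-similar germ,
bc/NonRuledDivisors_birth.lean). [difficulty: open-problem] -/
@[route_item "route-ResolutionOfSingularities-RuledResidues", crux]
def NonRuledDivisors : Prop :=
  ∃ p : ℕ, p.Prime ∧ ∃ (k K : Type) (_ : Field k) (_ : CharP k p) (_ : Field K) (_ : Algebra k K), ∃ R : Subalgebra k K, R.FG ∧ IsFractionRing R K ∧ Set.Infinite {W : ValuationSubring K | ∃ hk : (∀ c : k, algebraMap k K c ∈ W), IsDiscreteValuationRing W ∧ (∃ B : Subalgebra k K, B.FG ∧ B.toSubring ≤ W.toSubring ∧ ∀ x : K, x ∈ W → ∃ b s : K, b ∈ B ∧ s ∈ B ∧ s ∉ W.nonunits ∧ x * s = b) ∧ (∃ h : R.toSubring ≤ W.toSubring, ¬ IsRegularLocalRing (Localization.AtPrime (Ideal.comap (Subring.inclusion h) (IsLocalRing.maximalIdeal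 W)))) ∧ ¬ (∃ (L : Subfield (IsLocalRing.ResidueField W)) (t : IsLocalRing.ResidueField W), (∀ c : k, IsLocalRing.residue W ⟨algebraMap k K c, hk c⟩ ∈ L) ∧ (∀ f : Polynomial L, f ≠ 0 → Polynomial.eval₂ L.subtype t f ≠ 0) ∧ (∀ x : IsLocalRing.ResidueField W, ∃ f g : Polynomial L, Polynomial.eval₂ L.subtype t g ≠ 0 ∧ x * Polynomial.eval₂ L.subtype t g = Polynomial.eval₂ L.subtype t f))}

/-- item stmt-ResolutionOfSingularities-18076 · crux · rank 3 · closed · proved by Summit.ResolutionOfSingularities.ResolutionOfSingularities.Theorems.RuledResiduesNonRuledCofinite.nonRuledCofinite_proof @ 136a02a34e6f (prover) · by planner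
why it might fail: it cannot fail mathematically (valuative criterion + finitely many codimension-one components over Sing R); the risk is Lean size — identifying HasResolution's source with finitely many affine k-subalgebras of K with all local rings regular.
sources: ZariskiSamuel1960, Hartshorne1977, Abhyankar1956Valuations, Literature.AlgebraicGeometry.Resolution.Scheme.HasResolution
[crux] EXCEPTIONAL PRIMES ARE FINITE — for every field k, field K and affine model R of K over k
(finitely generated, Frac R = K): if Spec R has a resolution of singularities then the set of
divisorial places W ⊇ R of K/k centred in Sing R that do NOT dominate a regular local ring of
dimension ≥ 2 of some affine model A of K (A finitely generated, Frac A = K, A ⊆ W, A regular at the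
centre of W with Krull dimension ≥ 2 there) is FINITE (such W are the local rings of the
codimension-one points of the resolution lying over Sing R; skeleton bc/NonRuledCofinite_birth.lean:
finitely many everywhere-regular charts + per-chart finiteness via denominator ideals). [difficulty:
L] -/
@[route_item "route-ResolutionOfSingularities-RuledResidues", crux]
def NonRuledCofinite : Prop :=
  ∀ (k K : Type) [Field k] [Field K] [Algebra k K] (R : Subalgebra k K), R.FG → IsFractionRing R K → Literature.AlgebraicGeometry.Resolution.Scheme.HasResolution (AlgebraicGeometry.Spec (CommRingCat.of R)) → Set.Finite {W : ValuationSubring K | (∀ c : k, algebraMap k K c ∈ W) ∧ IsDiscreteValuationRing W ∧ (∃ B : Subalgebra k K, B.FG ∧ B.toSubring ≤ W.toSubring ∧ ∀ x : K, x ∈ W → ∃ b s : K, b ∈ B ∧ s ∈ B ∧ s ∉ W.nonunits ∧ x * s = b) ∧ (∃ h : R.toSubring ≤ W.toSubring, ¬ IsRegularLocalRing (Localization.AtPrime (Ideal.comap (Subring.inclusion h) (IsLocalRing.maximalIdeal W)))) ∧ ¬ (∃ A : Subalgebra k K, A.FG ∧ IsFractionRing A K ∧ ∃ h : A.toSubring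 ≤ W.toSubring, IsRegularLocalRing (Localization.AtPrime (Ideal.comap (Subring.inclusion h) (IsLocalRing.maximalIdeal W))) ∧ (2 : WithBot ℕ∞) ≤ ringKrullDim (Localization.AtPrime (Ideal.comap (Subring.inclusion h) (IsLocalRing.maximalIdeal W))))}

/-- item stmt-ResolutionOfSingularities-18077 · crux · rank 4 · closed · proved by Summit.ResolutionOfSingularities.ResolutionOfSingularities.Theorems.RuledResiduesRegularModelRuled.regularModelRuled_proof @ 844008ffee8b (prover) · by planner
why it might fail: true (Abhyankar 1956 Prop. 3–4; Zariski–Samuel VI §14); transcription risks only: the order-valuation identification at the last quadratic transform and the dimension formula for the centre over an arbitrary (imperfect) k.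
sources: Abhyankar1956Valuations, ZariskiSamuel1960, arXiv:math/0207171
[crux] ABHYANKAR'S RULEDNESS (characteristic-free, any ground field) — a divisorial place W of K/k
dominating a REGULAR local ring of dimension ≥ 2 of an affine model A of K (A finitely generated,
Frac A = K, A ⊆ W) has residue field L(t): some subfield L ⊇ k of κ(W) and t ∈ κ(W) transcendental
over L with κ(W) = L(t). Proof plan (skeleton bc/RegularModelRuled_birth.lean): W is a prime divisor
of A_𝔮 (dimension formula), the quadratic sequence of A_𝔮 along W is finite (Abhyankar), its
penultimate member S is regular of dimension ≥ 2 with W the 𝔪_S-adic order valuation, whose residue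
field is κ(S)(t_1..t_c), c ≥ 1. [difficulty: M] -/
@[route_item "route-ResolutionOfSingularities-RuledResidues", crux]
def RegularModelRuled : Prop :=
  ∀ (k K : Type) [Field k] [Field K] [Algebra k K] (W : ValuationSubring K) (hk : ∀ c : k, algebraMap k K c ∈ W), IsDiscreteValuationRing W → (∃ B : Subalgebra k K, B.FG ∧ B.toSubring ≤ W.toSubring ∧ ∀ x : K, x ∈ W → ∃ b s : K, b ∈ B ∧ s ∈ B ∧ s ∉ W.nonunits ∧ x * s = b) → ∀ A : Subalgebra k K, A.FG → IsFractionRing A K → ∀ h : A.toSubring ≤ W.toSubring, IsRegularLocalRing (Localization.AtPrime (Ideal.comap (Subring.inclusion h) (IsLocalRing.maximalIdeal W))) → (2 : WithBot ℕ∞) ≤ ringKrullDim (Localization.AtPrime (Ideal.comap (Subring.inclusion h) (IsLocalRing.maximalIdeal W))) → ∃ (L : Subfield (IsLocalRing.ResidueField W)) (t : IsLocalRing.ResidueField W), (∀ c : k, IsLocalRing.residue W ⟨algebraMap k K c, hk c⟩ ∈ L) ∧ (∀ f : Polynomial L, f ≠ 0 → Polynomial.eval₂ L.subtype t f ≠ 0)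 ∧ (∀ x : IsLocalRing.ResidueField W, ∃ f g : Polynomial L, Polynomial.eval₂ L.subtype t g ≠ 0 ∧ x * Polynomial.eval₂ L.subtype t g = Polynomial.eval₂ L.subtype t f)

/-- item stmt-ResolutionOfSingularities-18078 · assembly · rank 1 · open · by planner
sources: Abhyankar1956Valuations, arXiv:math/0207171
[assembly] NonRuledDivisors → RegularModelRuled → NonRuledCofinite → ¬ ResolutionOfSingularities
(refutation shape; the type of the deciding theorem `closes`). -/
@[route_item "route-ResolutionOfSingularities-RuledResidues"]
def Assembly : Prop :=
  NonRuledDivisors → RegularModelRuled → NonRuledCofinite → ¬ _root_.ResolutionOfSingularities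

/-! D-0027 §2.1 — DECIDING THEOREM (planner-authored via `route open/edit --closes-file`; by planner-plan-novel-ResolutionOfSingularities-Re-dc19aa3a-d-v 2026-08-17T07:47:19Z):
its hypotheses are this route's items and its conclusion the sub-problem Statement (glue_lint), and it elaborates with this file. -/

@[closes "route-ResolutionOfSingularities-RuledResidues"] theorem closes (hW : NonRuledDivisors) (hA : RegularModelRuled) (hF : NonRuledCofinite) :
    ¬ _root_.ResolutionOfSingularities := by
  intro hRes
  obtain ⟨p, hp, k, K, _, _, _, _, R, hR, hfr, hinf⟩ := hW
  have h : Literature.AlgebraicGeometry.Resolution.ResolutionInChar.{0} p :=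
    (_root_.ResolutionOfSingularities_iff).1 hRes p hp
  haveI : Algebra.FiniteType k R := R.fg_iff_finiteType.mp hR
  -- the summit, instantiated at the affine model `Spec R → Spec k` (reduced: `R` is a domain;
  -- separated and quasi-compact: affine; locally of finite type: `R` is finitely generated)
  have hres : Literature.AlgebraicGeometry.Resolution.Scheme.HasResolution
      (AlgebraicGeometry.Spec (CommRingCat.of R)) := by
    let f : AlgebraicGeometry.Spec (.of R) ⟶ AlgebraicGeometry.Spec (.of k) :=
      AlgebraicGeometry.Spec.map (CommRingCat.ofHom (algebraMap k R))
    haveI : AlgebraicGeometry.LocallyOfFiniteType f :=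
      (AlgebraicGeometry.HasRingHomProperty.Spec_iff
        (P := @AlgebraicGeometry.LocallyOfFiniteType)).mpr (RingHom.finiteType_algebraMap.mpr ‹_›)
    exact h k (AlgebraicGeometry.Spec (.of R)) f inferInstance inferInstance inferInstance inferInstance
  -- all but finitely many divisorial places centred in `Sing R` admit a good regular model …
  have hfin := hF k K R hR hfr hres
  apply hinf
  refine hfin.subset ?_
  intro W hWmem
  obtain ⟨hk, hdvr, hft, hsing, hnr⟩ := hWmem
  refine ⟨hk, hdvr, hft, hsing, ?_⟩
  -- … and a good regular model makes the residue field ruled (Abhyankar), contradicting the witness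
  rintro ⟨A, hAfg, hAfr, h', hreg, hdim⟩
  exact hnr (hA k K W hk hdvr hft A hAfg hAfr h' hreg hdim)

end Summit.ResolutionOfSingularities.ResolutionOfSingularities.Theses.RuledResidues
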